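import Summits.FinalStateConjecture.FinalStateConjecture.Theorems.ClusterCompletenessAdiabaticMultiKerrILEDTailsCutWeightedGraph
import Summits.FinalStateConjecture.FinalStateConjecture.Theorems.ClusterCompletenessAdiabaticMultiKerrILEDSlabWeightedExhaustion
import Summits.FinalStateConjecture.FinalStateConjecture.Theorems.ClusterCompletenessAdiabaticMultiKerrILEDQuadraticDecomposition
import Summits.FinalStateConjecture.FinalStateConjecture.Theorems.ClusterCompletenessAdiabaticMultiKerrILEDRadialWaveOperator
import Summits.FinalStateConjecture.FinalStateConjecture.Theorems.ClusterCompletenessAdiabaticMultiKerrILEDMorawetzLeafFlux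
import Summits.FinalStateConjecture.FinalStateConjecture.Theorems.ClusterCompletenessAdiabaticMultiKerrILEDRestFrameFarEnergyBound

/-!
# Route ClusterCompleteness — crux `AdiabaticMultiKerrILED`, line `Sketch`:
# tools for the photon-sphere angular estimate (Lagrangian current of a radial bump)

Helper file for the crux `stmt-FinalStateConjecture-14310`
(`Summit.FinalStateConjecture.FinalStateConjecture.Theses.ClusterCompleteness.AdiabaticMultiKerrILED`),
line `Sketch`, stub `lagrangianCurrent_leafFlux_abs_le` (lead c7, wave 8); everything here is consumed
by the stub `restFrame_photonSphere_angular_le` (file `…PhotonSphereAngular.lean`).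

Rest frame, zero spin: `G₀ = KerrSchild.inverseMetric (χ(2 − r/8M) · 2H) ℓ♯`, `r = Kerr.radius 0`,
`χ = Real.smoothTransition`. Contents: the smooth photon-sphere bump
`θ(t) = χ((4t − 9M)/M) χ((15M − 4t)/M)` (`= 1` on `[5M/2, 7M/2]`, `= 0` off `(9M/4, 15M/4)`); the
vanishing of the Lagrangian current `L = KerrSchild.lagrangianCurrent G (θ ∘ r) Φ` of a radial weight
off the support of `θ`; the leaf estimate `|∑_μ L^μ n_μ| ≤ (16 + 16 c M)(M ∑(∂Φ)² + Φ²/M)`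
(**registered stub** `lagrangianCurrent_leafFlux_abs_le`); `Wt L ∈ C¹(ℝ⁴)` for the static weight
`Wt = χ(u₂/ε − 1) χ(2 − ‖x⃗‖²/R²)`; `Wt ≡ 1` near the slab points of the shell; and the pointwise
inequality `θ |∇̸Φ|² − 9 θ (∂₀Φ)² − ½ |□θ| Φ² ≤ ∑ ∂_μ L^μ` on `{9M/4 ≤ r ≤ 8M}`
(`KerrSchild.sum_fderiv_lagrangianCurrent`, `waveOperator_radial_tailsCut`,
`inverseMetric_quadratic_decomposition_tailsCut`). Dafermos–Rodnianski arXiv:0811.0354, §4.1.2;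
Dafermos–Rodnianski–Shlapentokh-Rothman arXiv:1402.7034, §2.3. [folklore]
-/

noncomputable section

-- the doubled `FinalStateConjecture.FinalStateConjecture` path component trips dupNamespace
set_option linter.dupNamespace false

open Set Filter MeasureTheory
open scoped BigOperators Topology ENNReal ContDiff
open Literature.Geometry.Lorentzian

namespace Summit.FinalStateConjecture.FinalStateConjecture.Theorems

/-- The photon-sphere bump is smooth. [folklore] -/
theorem psAng_bump_contDiff (M : ℝ) {n : ℕ∞} :
    ContDiff ℝ n (fun t : ℝ ↦ Real.smoothTransition ((4 * t - 9 * M) / M) *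
      Real.smoothTransition ((15 * M - 4 * t) / M)) :=
  (Real.smoothTransition.contDiff.comp
    (((contDiff_const.mul contDiff_id).sub contDiff_const).div_const M)).mul
    (Real.smoothTransition.contDiff.comp
      ((contDiff_const.sub (contDiff_const.mul contDiff_id)).div_const M))

/-- The photon-sphere bump vanishes off `(9M/4, 15M/4)` (`M > 0`). [folklore] -/
theorem psAng_bump_eq_zero {M t : ℝ} (hM : 0 < M) (ht : t < 9 * M / 4 ∨ 15 * M / 4 < t) :
    Real.smoothTransition ((4 * t - 9 * M) / M) * Real.smoothTransition ((15 * M - 4 * t) / M) =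
      0 := by
  rcases ht with ht | ht
  · rw [Real.smoothTransition.zero_of_nonpos
      (div_nonpos_of_nonpos_of_nonneg (by linarith) hM.le), zero_mul]
  · rw [Real.smoothTransition.zero_of_nonpos (x := (15 * M - 4 * t) / M)
      (div_nonpos_of_nonpos_of_nonneg (by linarith) hM.le), mul_zero]

/-- The photon-sphere bump is `1` on `[5M/2, 7M/2]` (`M > 0`). [folklore] -/
theorem psAng_bump_eq_one {M t : ℝ} (hM : 0 < M) (h1 : 5 * M / 2 ≤ t) (h2 : t ≤ 7 * M / 2) :
    Real.smoothTransition ((4 * t - 9 * M) / M) * Real.smoothTransition ((15 * M - 4 * t) / M) =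
      1 := by
  rw [Real.smoothTransition.one_of_one_le ((one_le_div hM).mpr (by linarith)),
    Real.smoothTransition.one_of_one_le ((one_le_div hM).mpr (by linarith)), one_mul]

/-- The photon-sphere bump takes values in `[0, 1]`. [folklore] -/
theorem psAng_bump_mem (M t : ℝ) :
    0 ≤ Real.smoothTransition ((4 * t - 9 * M) / M) * Real.smoothTransition ((15 * M - 4 * t) / M) ∧
      Real.smoothTransition ((4 * t - 9 * M) / M) *
        Real.smoothTransition ((15 * M - 4 * t) / M) ≤ 1 :=
  ⟨mul_nonneg (Real.smoothTransition.nonneg _) (Real.smoothTransition.nonneg _),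
    mul_le_one₀ (Real.smoothTransition.le_one _) (Real.smoothTransition.nonneg _)
      (Real.smoothTransition.le_one _)⟩

/-- Where a weight `θ` vanishes on an open set `V` of radii, `θ′ = 0` on `V`. [folklore] -/
theorem psAng_deriv_eq_zero {θ : ℝ → ℝ} {V : Set ℝ} (hV : IsOpen V) (hθ : ∀ t ∈ V, θ t = 0)
    {t : ℝ} (ht : t ∈ V) : deriv θ t = 0 := by
  have h : θ =ᶠ[𝓝 t] fun _ ↦ 0 := eventuallyEq_of_mem (hV.mem_nhds ht) hθ
  rw [h.deriv_eq, deriv_const]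

/-- Where `θ` vanishes on an open set `V` of radii, the radial expression
`r⁻² (s² f θ′)′(r)` of `□_{G₀} (θ ∘ r)` vanishes for `r ∈ V`. [folklore] -/
theorem psAng_radialBox_eq_zero {θ : ℝ → ℝ} {V : Set ℝ} (hV : IsOpen V) (hθ : ∀ t ∈ V, θ t = 0)
    (M : ℝ) {r : ℝ} (hr : r ∈ V) :
    r⁻¹ ^ 2 * deriv (fun s ↦ s ^ 2 *
      (fun s : ℝ ↦ 1 - Real.smoothTransition (2 - s / (8 * M)) * (2 * M / s)) s * deriv θ s) r =
      0 := by
  have h : (fun s ↦ s ^ 2 *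
      (fun s : ℝ ↦ 1 - Real.smoothTransition (2 - s / (8 * M)) * (2 * M / s)) s * deriv θ s)
      =ᶠ[𝓝 r] fun _ ↦ 0 :=
    eventuallyEq_of_mem (hV.mem_nhds hr) fun s hs ↦ by
      simp only [psAng_deriv_eq_zero hV hθ hs, mul_zero]
  rw [h.deriv_eq, deriv_const, mul_zero]

/-- Where `θ` vanishes on an open set `V` of radii, `θ ∘ r` and `d(θ ∘ r)` vanish at the points
with `r ∈ V` (`r = Kerr.radius 0` is continuous). [folklore] -/
theorem psAng_comp_radius_eq_zero {θ : ℝ → ℝ} {V : Set ℝ} (hV : IsOpen V)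
    (hθ : ∀ t ∈ V, θ t = 0) {y : E4} (hy : Kerr.radius 0 y ∈ V) :
    θ (Kerr.radius 0 y) = 0 ∧ fderiv ℝ (fun z ↦ θ (Kerr.radius 0 z)) y = 0 := by
  refine ⟨hθ _ hy, ?_⟩
  have h : (fun z ↦ θ (Kerr.radius 0 z)) =ᶠ[𝓝 y] fun _ ↦ 0 :=
    eventuallyEq_of_mem ((hV.preimage (Kerr.continuous_radius 0)).mem_nhds hy) fun z hz ↦
      hθ _ hz
  rw [h.fderiv_eq, fderiv_const_apply]

/-- Where `θ` vanishes on an open set `V` of radii, the Lagrangian current of the weight `θ ∘ r`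
vanishes at the points with `r ∈ V`. [folklore] -/
theorem psAng_lagrangian_eq_zero (G : E4 → Fin 4 → Fin 4 → ℝ) (Φ : E4 → ℝ) {θ : ℝ → ℝ}
    {V : Set ℝ} (hV : IsOpen V) (hθ : ∀ t ∈ V, θ t = 0) {y : E4} (hy : Kerr.radius 0 y ∈ V)
    (μ : Fin 4) : KerrSchild.lagrangianCurrent G (fun z ↦ θ (Kerr.radius 0 z)) Φ y μ = 0 := by
  obtain ⟨h0, h1⟩ := psAng_comp_radius_eq_zero hV hθ hy
  simp [KerrSchild.lagrangianCurrent, h0, h1]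

/-- Where `θ` vanishes on an open set `V` of radii, the divergence of any weighted Lagrangian
current `W L` vanishes at the points with `r ∈ V` (it vanishes identically nearby). [folklore] -/
theorem psAng_sum_fderiv_weighted_eq_zero (G : E4 → Fin 4 → Fin 4 → ℝ) (Φ W : E4 → ℝ)
    {θ : ℝ → ℝ} {V : Set ℝ} (hV : IsOpen V) (hθ : ∀ t ∈ V, θ t = 0) {x : E4}
    (hx : Kerr.radius 0 x ∈ V) :
    ∑ μ, fderiv ℝ (fun y ↦ W y * KerrSchild.lagrangianCurrent G (fun z ↦ θ (Kerr.radius 0 z)) Φ y μ)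
      x (E4.basisVector μ) = 0 := by
  refine Finset.sum_eq_zero fun μ _ ↦ ?_
  have h : (fun y ↦ W y * KerrSchild.lagrangianCurrent G (fun z ↦ θ (Kerr.radius 0 z)) Φ y μ)
      =ᶠ[𝓝 x] fun _ ↦ 0 :=
    eventuallyEq_of_mem ((hV.preimage (Kerr.continuous_radius 0)).mem_nhds hx) fun y hy ↦ by
      rw [psAng_lagrangian_eq_zero G Φ hV hθ hy, mul_zero]
  rw [h.fderiv_eq, fderiv_const_apply]
  rfl

/-- For a smooth weight `θ`, the radial expression `r ↦ r⁻² (s² f θ′)′(r)` of `□_{G₀}(θ ∘ r)`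
(`f(s) = 1 − χ(2 − s/8M) · 2M/s`) is continuous off `r = 0`. [folklore] -/
theorem psAng_continuousAt_radialBox {θ : ℝ → ℝ} (hθ : ContDiff ℝ ∞ θ) (M : ℝ) {r : ℝ}
    (hr : r ≠ 0) :
    ContinuousAt (fun r : ℝ ↦ r⁻¹ ^ 2 * deriv (fun s ↦ s ^ 2 *
      (fun s : ℝ ↦ 1 - Real.smoothTransition (2 - s / (8 * M)) * (2 * M / s)) s * deriv θ s) r)
      r := by
  have hθ' : ContDiff ℝ ∞ (deriv θ) := (contDiff_infty_iff_deriv.1 hθ).2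
  have hid : ContDiffAt ℝ ∞ (fun t : ℝ ↦ t) r := contDiffAt_id
  have hf : ContDiffAt ℝ ∞
      (fun s : ℝ ↦ 1 - Real.smoothTransition (2 - s / (8 * M)) * (2 * M / s)) r :=
    contDiffAt_const.sub ((Real.smoothTransition.contDiff.contDiffAt.comp r
      (contDiffAt_const.sub (hid.div_const _))).mul (contDiffAt_const.div hid hr))
  have hg : ContDiffAt ℝ ∞ (fun s ↦ s ^ 2 *
      (fun s : ℝ ↦ 1 - Real.smoothTransition (2 - s / (8 * M)) * (2 * M / s)) s * deriv θ s) r :=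
    ((hid.pow 2).mul hf).mul hθ'.contDiffAt
  have hdg : ContDiffAt ℝ 0 (deriv fun s ↦ s ^ 2 *
      (fun s : ℝ ↦ 1 - Real.smoothTransition (2 - s / (8 * M)) * (2 * M / s)) s * deriv θ s) r :=
    hg.derivWithin (by exact_mod_cast le_top)
  exact ((continuousAt_id.inv₀ hr).pow 2).mul hdg.continuousAt

/-- Chain rule bound: `|∂_ν (θ ∘ r)(x)| ≤ |θ′(r(x))|` off the axis (`|∂_ν r| ≤ 1`). [folklore] -/
theorem psAng_abs_fderiv_comp_radius_le {θ : ℝ → ℝ} {x : E4} (hx : 0 < Kerr.radius 0 x)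
    (hθ : DifferentiableAt ℝ θ (Kerr.radius 0 x)) (ν : Fin 4) :
    |fderiv ℝ (fun z ↦ θ (Kerr.radius 0 z)) x (E4.basisVector ν)| ≤
      |deriv θ (Kerr.radius 0 x)| := by
  rw [(hardy_hasFDerivAt_comp_radius rfl hx hθ.hasDerivAt).fderiv, smul_apply,
    morawetzLeaf_radCovector_apply, smul_eq_mul, abs_mul, abs_mul, abs_inv, abs_of_pos hx]
  have hle : |(if ν = 0 then (0 : ℝ) else x ν)| ≤ Kerr.radius 0 x := by
    split_ifs with h
    · rw [abs_zero]
      exact hx.le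
    · exact morawetzLeaf_abs_apply_le_radius x h
  calc |deriv θ (Kerr.radius 0 x)| * (Kerr.radius 0 x)⁻¹ * |(if ν = 0 then (0 : ℝ) else x ν)|
      ≤ |deriv θ (Kerr.radius 0 x)| * (Kerr.radius 0 x)⁻¹ * Kerr.radius 0 x := by gcongr
    _ = |deriv θ (Kerr.radius 0 x)| := by
        rw [mul_assoc, inv_mul_cancel₀ hx.ne', mul_one]

/-- **The angular gradient is non-negative**: `(x⃗ · ∇Φ / r)² ≤ ∑ᵢ (∂ᵢΦ)²` off the axis
(Cauchy–Schwarz in `ℝ³`, `r² = ∑ xᵢ²`). [folklore] -/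
theorem psAng_angular_nonneg (Φ : E4 → ℝ) {x : E4} (hx : 0 < Kerr.radius 0 x) :
    0 ≤ (∑ i : Fin 3, fderiv ℝ Φ x (E4.basisVector i.succ) ^ 2) -
      ((∑ i : Fin 3, x i.succ * fderiv ℝ Φ x (E4.basisVector i.succ)) / Kerr.radius 0 x) ^ 2 := by
  have hsq : Kerr.radius 0 x ^ 2 = x 1 ^ 2 + x 2 ^ 2 + x 3 ^ 2 := by
    rw [Kerr.radius_zero_left, E4.spatialNorm_sq]
  obtain ⟨p, hp⟩ : ∃ p : Fin 4 → ℝ, ∀ β, fderiv ℝ Φ x (E4.basisVector β) = p β :=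
    ⟨_, fun _ ↦ rfl⟩
  simp only [hp, Fin.sum_univ_three, Fin.succ_zero_eq_one, Fin.succ_one_eq_two,
    Kerr.fin_succ_two_eq_three]
  rw [div_pow, sub_nonneg, div_le_iff₀ (by positivity), hsq]
  nlinarith [sq_nonneg (x 1 * p 2 - x 2 * p 1), sq_nonneg (x 1 * p 3 - x 3 * p 1),
    sq_nonneg (x 2 * p 3 - x 3 * p 2)]

/-- **Leaf estimate for a Lagrangian current.** If `|G^{αβ}(x)| ≤ 2`, `|n_μ| ≤ 1`, `|ϖ(x)| ≤ 1` and
`|∂_νϖ(x)| ≤ c_d` then `|∑_μ L^μ n_μ| ≤ (16 + 16 c_d M)(M ∑_μ (∂_μΦ)² + Φ²/M)` (`M > 0`):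
`|L^μ| ≤ 2|Φ| ∑|∂Φ| + 4 c_d Φ²`, `2|Φ|P ≤ Φ²/M + M P²`, `P² ≤ 4 ∑(∂Φ)²`.
Dafermos–Rodnianski–Shlapentokh-Rothman arXiv:1402.7034, §2.3.2. [folklore] -/
theorem lagrangianCurrent_leafFlux_abs_le : ∀ (G : E4 → Fin 4 → Fin 4 → ℝ) (ϖ Φ : E4 → ℝ) (x : E4) (n : Fin 4 → ℝ) (M c : ℝ), 0 < M → 0 ≤ c → (∀ α β : Fin 4, |G x α β| ≤ 2) → (∀ μ : Fin 4, |n μ| ≤ 1) → |ϖ x| ≤ 1 → (∀ ν : Fin 4, |fderiv ℝ ϖ x (E4.basisVector ν)| ≤ c) → |∑ μ, KerrSchild.lagrangianCurrent G ϖ Φ x μ * n μ| ≤ (16 + 16 * c * M) * (M * (∑ μ : Fin 4, fderiv ℝ Φ x (E4.basisVector μ) ^ 2) + Φ x ^ 2 / M) := by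
  intro G ϖ Φ x n M cd hM hcd hG hn hϖ hdϖ
  obtain ⟨p, hp⟩ : ∃ p : Fin 4 → ℝ, ∀ β, fderiv ℝ Φ x (E4.basisVector β) = p β :=
    ⟨_, fun _ ↦ rfl⟩
  obtain ⟨d, hd⟩ : ∃ d : Fin 4 → ℝ, ∀ β, fderiv ℝ ϖ x (E4.basisVector β) = d β :=
    ⟨_, fun _ ↦ rfl⟩
  simp only [hp]
  set S : ℝ := ∑ μ, p μ ^ 2 with hS
  set P : ℝ := ∑ μ, |p μ| with hP
  set Q : ℝ := Φ x ^ 2 / M with hQ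
  have hS0 : 0 ≤ S := Finset.sum_nonneg fun μ _ ↦ sq_nonneg _
  have hP0 : 0 ≤ P := Finset.sum_nonneg fun μ _ ↦ abs_nonneg _
  have hQ0 : 0 ≤ Q := by positivity
  have hP2 : P ^ 2 ≤ 4 * S := Kerr.sq_sum_abs_le_four_mul p
  have hA : ∀ μ, |∑ ν, G x μ ν * p ν| ≤ 2 * P := fun μ ↦ KerrSchild.abs_contract_le (G x) p hG μ
  have hD : ∀ μ, |∑ ν, G x μ ν * d ν| ≤ 2 * (4 * cd) := fun μ ↦ by
    refine (KerrSchild.abs_contract_le (G x) d hG μ).trans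
      (mul_le_mul_of_nonneg_left ?_ zero_le_two)
    calc ∑ ν, |d ν| ≤ ∑ _ν : Fin 4, cd := Finset.sum_le_sum fun ν _ ↦ (hd ν) ▸ hdϖ ν
      _ = 4 * cd := by
          rw [Finset.sum_const, Finset.card_univ, Fintype.card_fin, nsmul_eq_mul, Nat.cast_ofNat]
  have hL : ∀ μ, |KerrSchild.lagrangianCurrent G ϖ Φ x μ| ≤ 4 * M * S + (1 + 4 * cd * M) * Q := by
    intro μ
    simp only [KerrSchild.lagrangianCurrent, hp, hd]
    have h1 : |ϖ x * Φ x * ∑ ν, G x μ ν * p ν| ≤ 1 * |Φ x| * (2 * P) := by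
      rw [abs_mul, abs_mul]
      exact mul_le_mul (mul_le_mul_of_nonneg_right hϖ (abs_nonneg _)) (hA μ) (abs_nonneg _)
        (by positivity)
    have h2 : |2⁻¹ * Φ x ^ 2 * ∑ ν, G x μ ν * d ν| ≤ 2⁻¹ * Φ x ^ 2 * (2 * (4 * cd)) := by
      rw [abs_mul, abs_mul, abs_of_pos (by norm_num : (0 : ℝ) < 2⁻¹), abs_of_nonneg (sq_nonneg _)]
      exact mul_le_mul_of_nonneg_left (hD μ) (by positivity)
    have h3 : 1 * |Φ x| * (2 * P) ≤ 4 * M * S + Q := by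
      have key : 2 * |Φ x| * P ≤ Q + M * P ^ 2 := by
        rw [← sub_nonneg]
        have : Q + M * P ^ 2 - 2 * |Φ x| * P = (|Φ x| - M * P) ^ 2 / M := by
          rw [hQ, ← sq_abs (Φ x)]
          field_simp
          ring
        rw [this]
        positivity
      nlinarith [key, mul_le_mul_of_nonneg_left hP2 hM.le]
    have h4 : 2⁻¹ * Φ x ^ 2 * (2 * (4 * cd)) = 4 * cd * M * Q := by
      rw [hQ]
      field_simp
    calc |ϖ x * Φ x * ∑ ν, G x μ ν * p ν - 2⁻¹ * Φ x ^ 2 * ∑ ν, G x μ ν * d ν|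
        ≤ |ϖ x * Φ x * ∑ ν, G x μ ν * p ν| + |2⁻¹ * Φ x ^ 2 * ∑ ν, G x μ ν * d ν| := abs_sub _ _
      _ ≤ (4 * M * S + Q) + 2⁻¹ * Φ x ^ 2 * (2 * (4 * cd)) := add_le_add (h1.trans h3) h2
      _ = 4 * M * S + (1 + 4 * cd * M) * Q := by rw [h4]; ring
  refine (morawetzLeaf_abs_sum_mul_le hL hn).trans ?_
  nlinarith [mul_nonneg (mul_nonneg hcd hM.le) (mul_nonneg hM.le hS0), hQ0]

/-- **`Wt L^μ ∈ C¹(ℝ⁴)`** for the static weight `Wt = χ(u₂/ε − 1) χ(2 − ‖x⃗‖²/R²)` (`M, ε > 0`),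
a coefficient field `C¹` on `{r > 0}`, a `C²` radial weight `θ ∘ r` and `Φ ∈ C²`: at points with
`r > M` every factor is `C¹` (`Kerr.contDiff_horizonFactor`, `KerrSchild.contDiffAt_lagrangianCurrent`),
on `{r < 2M}` the horizon factor vanishes (`Kerr.contDiff_of_eq_zero_of_radius_lt`). [folklore] -/
theorem psAng_contDiff_weighted_lagrangian {M ε : ℝ} (R : ℝ) {G : E4 → Fin 4 → Fin 4 → ℝ}
    {θ : ℝ → ℝ} {Φ : E4 → ℝ} (hM : 0 < M) (hε : 0 < ε)
    (hG : ∀ x : E4, 0 < Kerr.radius 0 x → ∀ μ ν, ContDiffAt ℝ 1 (fun y ↦ G y μ ν) x)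
    (hθ : ContDiff ℝ 2 θ) (hΦ : ContDiff ℝ 2 Φ) (μ : Fin 4) :
    ContDiff ℝ 1 fun y ↦ (Real.smoothTransition (Kerr.horizonFn M 0 y / ε - 1) *
      Real.smoothTransition (2 - E4.spatialNorm y ^ 2 / R ^ 2)) *
      KerrSchild.lagrangianCurrent G (fun z ↦ θ (Kerr.radius 0 z)) Φ y μ := by
  have hrp : 0 < Kerr.rPlus M 0 := by
    rw [Kerr.rPlus_zero_right hM.le]
    positivity
  refine Kerr.contDiff_of_eq_zero_of_radius_lt (a := 0) (c := 2 * M) (by positivity)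
    (fun x hx ↦ ?_) (fun x hx ↦ ?_)
  · have h1 : Kerr.horizonFn M 0 x < ε := by
      refine lt_of_le_of_lt ?_ hε
      unfold Kerr.horizonFn
      rw [Kerr.rPlus_zero_right hM.le]
      exact mul_nonpos_iff.mpr (Or.inr ⟨by linarith, (Real.exp_pos _).le⟩)
    rw [tailsCutWeight_eq_zero_of_horizonFn_lt hε h1, zero_mul]
  · have hxpos : 0 < Kerr.radius 0 x := lt_trans (by positivity) hx
    have hW₁ : ContDiffAt ℝ 1 (fun y ↦ Real.smoothTransition (Kerr.horizonFn M 0 y / ε - 1)) x :=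
      (Kerr.contDiff_horizonFactor (a := 0) (n := 1) hrp hε).contDiffAt
    have hW₂ : ContDiffAt ℝ 1
        (fun y : E4 ↦ Real.smoothTransition (2 - E4.spatialNorm y ^ 2 / R ^ 2)) x :=
      ((Real.smoothTransition.contDiff (n := 1)).comp
        (contDiff_const.sub (Kerr.contDiff_spatialNorm_sq.div_const _))).contDiffAt
    have hθr : ContDiffAt ℝ 2 (fun z ↦ θ (Kerr.radius 0 z)) x :=
      hθ.contDiffAt.comp x (Kerr.contDiffAt_radius hxpos)
    exact (hW₁.mul hW₂).mul
      (KerrSchild.contDiffAt_lagrangianCurrent (hG x hxpos) hθr hΦ.contDiffAt μ)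

/-- **The static weight is identically `1` near a slab point of the shell.** For
`16 ε e^{(s+|F(0)|+2R)/(2M)} ≤ M`, `4M ≤ R`, `F(y) ≤ |F(0)| + ‖y‖/2`, at a point `x` with
`x⁰ ≤ s + F(x⃗)` and `9M/4 ≤ r ≤ 15M/4` one has `u₂(x) > 2ε` and `‖x⃗‖ < R`, so both factors of
`Wt = χ(u₂/ε − 1) χ(2 − ‖x⃗‖²/R²)` are `1` on a neighbourhood of `x`. [folklore] -/
theorem psAng_weight_eventuallyEq_one {M ε R s : ℝ} {F : E3 → ℝ} (hM : 0 < M) (hε : 0 < ε)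
    (hR : 4 * M ≤ R) (hεM : 16 * ε * Real.exp ((s + |F 0| + 2 * R) / (2 * M)) ≤ M)
    (hFub : ∀ y : E3, F y ≤ |F 0| + 2⁻¹ * ‖y‖) {x : E4} (hxs : x 0 ≤ s + F (E4.spatial x))
    (h1 : 9 * M / 4 ≤ Kerr.radius 0 x) (h2 : Kerr.radius 0 x ≤ 15 * M / 4) :
    (fun y : E4 ↦ Real.smoothTransition (Kerr.horizonFn M 0 y / ε - 1) *
      Real.smoothTransition (2 - E4.spatialNorm y ^ 2 / R ^ 2)) =ᶠ[𝓝 x] fun _ ↦ 1 := by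
  have hr : Kerr.radius 0 x = E4.spatialNorm x := Kerr.radius_zero_left x
  have hR0 : 0 < R := by linarith
  set E : ℝ := Real.exp ((s + |F 0| + 2 * R) / (2 * M)) with hE
  have hEpos : 0 < E := Real.exp_pos _
  have hh : 2 * ε < Kerr.horizonFn M 0 x := by
    unfold Kerr.horizonFn
    rw [Kerr.rPlus_zero_right hM.le]
    have hx0 : x 0 ≤ s + |F 0| + 2 * R := by
      have hF := hFub (E4.spatial x)
      have hn : ‖E4.spatial x‖ = Kerr.radius 0 x := hr.symm
      rw [hn] at hF
      linarith
    have hexp : E⁻¹ ≤ Real.exp (-((2 * M)⁻¹ * x 0)) := by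
      rw [hE, ← Real.exp_neg, Real.exp_le_exp, neg_le_neg_iff, div_eq_inv_mul]
      exact mul_le_mul_of_nonneg_left hx0 (by positivity)
    have hεE : 2 * ε ≤ M / 8 * E⁻¹ := by
      rw [mul_comm (M / 8), ← div_eq_inv_mul, le_div_iff₀ hEpos]
      linarith
    calc 2 * ε ≤ M / 8 * E⁻¹ := hεE
      _ < M / 4 * E⁻¹ := mul_lt_mul_of_pos_right (by linarith) (inv_pos.mpr hEpos)
      _ ≤ (Kerr.radius 0 x - 2 * M) * Real.exp (-((2 * M)⁻¹ * x 0)) :=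
          mul_le_mul (by linarith) hexp (inv_pos.mpr hEpos).le (by linarith)
  have hsn : E4.spatialNorm x < R := by linarith
  have hev1 : ∀ᶠ y in 𝓝 x, 2 * ε < Kerr.horizonFn M 0 y :=
    continuousAt_const.eventually_lt (Kerr.continuous_horizonFn M 0).continuousAt hh
  have hev2 : ∀ᶠ y in 𝓝 x, E4.spatialNorm y < R :=
    E4.continuous_spatialNorm.continuousAt.eventually_lt continuousAt_const hsn
  filter_upwards [hev1, hev2] with y hy1 hy2
  rw [Kerr.weight_eq_one_of_le_horizonFn hε hy1.le, one_mul]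
  refine Real.smoothTransition.one_of_one_le ?_
  have h3 : E4.spatialNorm y ^ 2 / R ^ 2 ≤ 1 := by
    rw [div_le_one (by positivity)]
    exact pow_le_pow_left₀ (E4.spatialNorm_nonneg _) hy2.le 2
  linarith

/-- **The pointwise photon-sphere angular inequality.** At a point with `9M/4 ≤ r ≤ 8M` where
`□_{G₀} Φ = 0`, for a weight `θ` of class `C²` at `r(x)` with `θ(r(x)) ≥ 0`:
`θ |∇̸Φ|² − (9 θ (∂₀Φ)² + ½ |r⁻²(r² f θ′)′| Φ²) ≤ ∑_μ ∂_μ L^μ`, `L` the Lagrangian current of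
`θ ∘ r` — from `∑ ∂_μ L^μ = θ Q − ½ (□θ) Φ²` (`KerrSchild.sum_fderiv_lagrangianCurrent`),
`□(θ ∘ r) = r⁻²(r² f θ′)′` (`waveOperator_radial_tailsCut`),
`Q = −(∂₀Φ)²/f + (∂_{r*}Φ)²/f + |∇̸Φ|²` (`inverseMetric_quadratic_decomposition_tailsCut`) and
`f = 1 − 2M/r ≥ 1/9`. Dafermos–Rodnianski arXiv:0811.0354, §4.1.2. [folklore] -/
theorem psAng_bulk_le_sum_fderiv {M : ℝ} {θ : ℝ → ℝ} {Φ : E4 → ℝ} {x : E4} (hM : 0 < M)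
    (h1 : 9 * M / 4 ≤ Kerr.radius 0 x) (h2 : Kerr.radius 0 x ≤ 8 * M)
    (hθ : ContDiffAt ℝ 2 θ (Kerr.radius 0 x)) (hθ0 : 0 ≤ θ (Kerr.radius 0 x))
    (hΦ : ContDiffAt ℝ 2 Φ x)
    (hwave : KerrSchild.waveOperator (KerrSchild.inverseMetric
      (fun y ↦ Real.smoothTransition (2 - Kerr.radius 0 y / (8 * M)) * (2 * Kerr.scalarH M 0 y))
      (Kerr.nullVector 0)) Φ x = 0) :
    θ (Kerr.radius 0 x) * ((∑ i : Fin 3, fderiv ℝ Φ x (E4.basisVector i.succ) ^ 2) -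
        ((∑ i : Fin 3, x i.succ * fderiv ℝ Φ x (E4.basisVector i.succ)) / Kerr.radius 0 x) ^ 2) -
      (9 * θ (Kerr.radius 0 x) * fderiv ℝ Φ x (E4.basisVector 0) ^ 2 +
        2⁻¹ * |(Kerr.radius 0 x)⁻¹ ^ 2 * deriv (fun s ↦ s ^ 2 *
          (fun s : ℝ ↦ 1 - Real.smoothTransition (2 - s / (8 * M)) * (2 * M / s)) s * deriv θ s)
          (Kerr.radius 0 x)| * Φ x ^ 2) ≤
    ∑ μ, fderiv ℝ (fun y ↦ KerrSchild.lagrangianCurrent (KerrSchild.inverseMetric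
      (fun y ↦ Real.smoothTransition (2 - Kerr.radius 0 y / (8 * M)) * (2 * Kerr.scalarH M 0 y))
      (Kerr.nullVector 0)) (fun z ↦ θ (Kerr.radius 0 z)) Φ y μ) x (E4.basisVector μ) := by
  have hr : 0 < Kerr.radius 0 x := lt_of_lt_of_le (by positivity) h1
  have h2M : 2 * M < Kerr.radius 0 x := by linarith
  have hG : ∀ μ ν, DifferentiableAt ℝ (fun y ↦ KerrSchild.inverseMetric
      (fun y ↦ Real.smoothTransition (2 - Kerr.radius 0 y / (8 * M)) * (2 * Kerr.scalarH M 0 y))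
      (Kerr.nullVector 0) y μ ν) x := fun μ ν ↦
    (contDiffAt_tailsCut_inverseMetric M 0 hr μ ν (n := 1)).differentiableAt one_ne_zero
  have hsymm := fun μ ν ↦ KerrSchild.inverseMetric_symm
    (fun y ↦ Real.smoothTransition (2 - Kerr.radius 0 y / (8 * M)) * (2 * Kerr.scalarH M 0 y))
    (Kerr.nullVector 0) x μ ν
  have hθr : ContDiffAt ℝ 2 (fun z ↦ θ (Kerr.radius 0 z)) x :=
    hθ.comp x (Kerr.contDiffAt_radius hr)
  have hφ1 := weightedT_profile_lt_one hM.le h2M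
  rw [KerrSchild.sum_fderiv_lagrangianCurrent hG hsymm hθr hΦ, hwave, mul_zero, add_zero,
    waveOperator_radial_tailsCut M θ x hM hr hθ,
    inverseMetric_quadratic_decomposition_tailsCut M Φ x hM hr hφ1,
    tailsCut_profile_eq_of_radius_le M 0 x hM h2, hardy_scalarH_zero]
  set ρ : ℝ := Kerr.radius 0 x with hρ
  set p₀ : ℝ := fderiv ℝ Φ x (E4.basisVector 0) with hp₀
  set S₃ : ℝ := ∑ i : Fin 3, x i.succ * fderiv ℝ Φ x (E4.basisVector i.succ) with hS₃
  set D' : ℝ := deriv (fun s ↦ s ^ 2 *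
    (fun s : ℝ ↦ 1 - Real.smoothTransition (2 - s / (8 * M)) * (2 * M / s)) s * deriv θ s) ρ
    with hD'
  have hMρ : M / ρ ≤ 4 / 9 := by
    rw [div_le_div_iff₀ hr (by norm_num)]
    linarith
  have hf0 : 0 < 1 - 2 * (M / ρ) := by linarith
  have k1 : 0 ≤ θ ρ * (((1 - 2 * (M / ρ)) * S₃ / ρ + 2 * (M / ρ) * p₀) ^ 2 / (1 - 2 * (M / ρ))) :=
    mul_nonneg hθ0 (div_nonneg (sq_nonneg _) hf0.le)
  have k2 : θ ρ * (p₀ ^ 2 / (1 - 2 * (M / ρ))) ≤ 9 * θ ρ * p₀ ^ 2 := by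
    rw [← mul_div_assoc, div_le_iff₀ hf0]
    nlinarith [mul_nonneg hθ0 (sq_nonneg p₀)]
  have k3 : ρ⁻¹ ^ 2 * D' * Φ x ^ 2 ≤ |ρ⁻¹ ^ 2 * D'| * Φ x ^ 2 :=
    mul_le_mul_of_nonneg_right (le_abs_self _) (sq_nonneg _)
  nlinarith [k1, k2, k3]

end Summit.FinalStateConjecture.FinalStateConjecture.Theorems
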